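import Mathlib
import Literature.NumberTheory.Transcendental.RoyCriterion
import Literature.NumberTheory.Transcendental.RoyCriterionProofs
import HarnessLib

/-!
# The universal content of the Hermite–Padé jet lattice of `exp` (Theorem U, divisibility)

For `P ∈ ℤ[X₀,X₁]` write `F(w) = P(w, e^w)` and `c_n(P) = F^{(n)}(0) = taylorInt n P`
(`Literature…taylorInt`, `= (DⁿP)(0,1)` with Roy's derivation `D = ∂₀ + X₁∂₁ = royD`).

**Theorem U (divisibility half).** If `c_n(P) = 0` for all `n < m` (i.e. `ord₀ F ≥ m`), then for
every prime `p`
  `p ^ v_p(⌊m/p⌋!) ∣ c_m(P)`,   equivalently   `v_p(c_m(P)) ≥ v_p(m!) − ⌊m/p⌋`,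
and hence `g_m ∣ c_m(P)` with `g_m = ∏_{p ≤ m} p^{v_p(⌊m/p⌋!)} = ∏_{j ≤ m} j / rad(j)`
(`1,1,1,1,2,2,2,2,8,24,…`; `log g_m = (0.7553…)·m + O(√m log m)`).

*Proof (algebraic, no analysis).* Put `z = e^w − 1`, so `w = log(1+z) = Σ_{j≥1} (−1)^{j+1}zʲ/j`.
The substitution `Φ : X₀ ↦ log(1+z), X₁ ↦ 1+z` is a ring map `ℤ[X₀,X₁] → ℚ⟦z⟧` intertwining
`D` with `θ = (1+z)·d/dz` (`= d/dw`) and evaluation at `(0,1)` with the constant term, so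
`c_n(P) = [z⁰] θⁿ Φ(P)`.  Since `θ` lowers the order by exactly one with the factor "order"
(`[zᵏ]θf = (k+1)f_{k+1} + k f_k`), the conditions `c_n(P) = 0 (n < m)` force
`[zᵏ]Φ(P) = 0 (k < m)` and then `c_m(P) = m! · [zᵐ]Φ(P)`.  Finally every coefficient of an
element of `ℤ[log(1+z), 1+z]` satisfies `|[zʲ]f|_p ≤ p^{⌊j/p⌋}` (the set `S_p` of such series is
closed under sums and products because `⌊i/p⌋+⌊j/p⌋ ≤ ⌊(i+j)/p⌋`, and contains `log(1+z)` because
`v_p(j) ≤ ⌊j/p⌋`), whence `|c_m(P)|_p ≤ p^{−v_p(m!)+⌊m/p⌋} = p^{−v_p(⌊m/p⌋!)}` (Legendre).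

Implementation: to stay definition-free, `θ` is any map with `θ f = (1+X)·f′` (hypothesis `hθ`),
and `Φ = MvPolynomial.aeval ![L, 1+X]` for any `L ∈ ℚ⟦X⟧` with `(1+X)·L′ = 1`, `L(0) = 0`
(hypotheses `hL`, `hL0`; the series `log(1+z)` is exhibited at the end).
This is the universal part of the saturation index of the jet map `P ↦ (c_n(P))_{n ≤ K}` entering
the covolume of the lattices of Padé-type forms in Roy's programme (solo paper §3d, Thms U/V/X).
Sharpness (`g_m` is attained) is the companion file `SoloBlindPadeContentSharp`. [this work] -/

noncomputable section

open Finset PowerSeries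

namespace Summit.Schanuel.Schanuel.Theorems

open Literature.NumberTheory.Transcendental

/-! ### The operator `θ = (1+z)·d/dz` -/

/-- Coefficient formula: `[zᵏ] θf = (k+1)·f_{k+1} + k·f_k`. [this work] -/
theorem coeff_jetTheta {θ : ℚ⟦X⟧ → ℚ⟦X⟧} (hθ : ∀ f, θ f = (1 + X) * d⁄dX ℚ f) (f : ℚ⟦X⟧)
    (k : ℕ) : coeff k (θ f) = ((k : ℚ) + 1) * coeff (k + 1) f + (k : ℚ) * coeff k f := by
  rw [hθ, add_mul, one_mul, map_add, coeff_derivative]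
  rcases k with _ | k
  · simp
  · rw [coeff_succ_X_mul, coeff_derivative]
    push_cast
    ring

/-- Leibniz rule for `θ`. [this work] -/
theorem jetTheta_mul {θ : ℚ⟦X⟧ → ℚ⟦X⟧} (hθ : ∀ f, θ f = (1 + X) * d⁄dX ℚ f) (f g : ℚ⟦X⟧) :
    θ (f * g) = θ f * g + f * θ g := by
  simp only [hθ, Derivation.leibniz, smul_eq_mul]
  ring

/-- `θ` kills constants. [this work] -/
theorem jetTheta_C {θ : ℚ⟦X⟧ → ℚ⟦X⟧} (hθ : ∀ f, θ f = (1 + X) * d⁄dX ℚ f) (a : ℚ) :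
    θ (C a) = 0 := by
  rw [hθ]; simp

/-- `θ(1+z) = 1+z`. [this work] -/
theorem jetTheta_one_add_X {θ : ℚ⟦X⟧ → ℚ⟦X⟧} (hθ : ∀ f, θ f = (1 + X) * d⁄dX ℚ f) :
    θ (1 + X) = 1 + X := by
  rw [hθ]; simp

/-! ### `θ` is unitriangular: the order drops by one, with the factor "order" -/

/-- If `f_k = 0` for `k < m+1` then `(θf)_k = 0` for `k < m` and `(θf)_m = (m+1) f_{m+1}`.
[this work] -/
theorem coeff_jetTheta_of_vanish {θ : ℚ⟦X⟧ → ℚ⟦X⟧} (hθ : ∀ f, θ f = (1 + X) * d⁄dX ℚ f)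
    {f : ℚ⟦X⟧} {m : ℕ} (h : ∀ k < m + 1, coeff k f = 0) :
    (∀ k < m, coeff k (θ f) = 0) ∧ coeff m (θ f) = ((m : ℚ) + 1) * coeff (m + 1) f := by
  refine ⟨fun k hk => ?_, ?_⟩
  · rw [coeff_jetTheta hθ, h k (by omega), h (k + 1) (by omega)]
    ring
  · rw [coeff_jetTheta hθ, h m (by omega)]
    ring

/-- Iterating: if `f_k = 0` for `k < m` and `n ≤ m`, then `(θⁿf)_k = 0` for `k < m − n` and
`(θⁿf)_{m−n} = m(m−1)⋯(m−n+1)·f_m`. [this work] -/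
theorem coeff_iterate_jetTheta_of_vanish {θ : ℚ⟦X⟧ → ℚ⟦X⟧}
    (hθ : ∀ f, θ f = (1 + X) * d⁄dX ℚ f) {f : ℚ⟦X⟧} {m : ℕ} (h : ∀ k < m, coeff k f = 0) :
    ∀ n ≤ m, (∀ k < m - n, coeff k (θ^[n] f) = 0) ∧
      coeff (m - n) (θ^[n] f) = (m.descFactorial n : ℚ) * coeff m f := by
  intro n
  induction n with
  | zero => intro _; simpa using h
  | succ n ih =>
    intro hn
    obtain ⟨ih1, ih2⟩ := ih (by omega)
    have hmn : m - n = (m - (n + 1)) + 1 := by omega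
    rw [hmn] at ih1 ih2
    obtain ⟨h1, h2⟩ := coeff_jetTheta_of_vanish hθ ih1
    refine ⟨fun k hk => ?_, ?_⟩
    · rw [Function.iterate_succ_apply']
      exact h1 k hk
    · rw [Function.iterate_succ_apply', h2, ih2, Nat.descFactorial_succ]
      have : ((m - (n + 1) : ℕ) : ℚ) + 1 = ((m - n : ℕ) : ℚ) := by
        rw [hmn]; push_cast; ring
      rw [this]
      push_cast
      ring

/-- Consequently `[z⁰]θᵐf = m!·f_m` … [this work] -/
theorem constantCoeff_iterate_jetTheta_eq {θ : ℚ⟦X⟧ → ℚ⟦X⟧}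
    (hθ : ∀ f, θ f = (1 + X) * d⁄dX ℚ f) {f : ℚ⟦X⟧} {m : ℕ} (h : ∀ k < m, coeff k f = 0) :
    constantCoeff (θ^[m] f) = (m.factorial : ℚ) * coeff m f := by
  rw [← coeff_zero_eq_constantCoeff_apply, ← Nat.descFactorial_self]
  have := (coeff_iterate_jetTheta_of_vanish hθ h m le_rfl).2
  rwa [Nat.sub_self] at this

/-- … and conversely, if `[z⁰]θⁿf = 0` for all `n < m` then `f_k = 0` for all `k < m`.
[this work] -/
theorem coeff_eq_zero_of_constantCoeff_iterate_jetTheta {θ : ℚ⟦X⟧ → ℚ⟦X⟧}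
    (hθ : ∀ f, θ f = (1 + X) * d⁄dX ℚ f) {f : ℚ⟦X⟧} :
    ∀ m, (∀ n < m, constantCoeff (θ^[n] f) = 0) → ∀ k < m, coeff k f = 0 := by
  intro m
  induction m with
  | zero => intro _ k hk; omega
  | succ m ih =>
    intro h k hk
    have hlow : ∀ k < m, coeff k f = 0 := ih fun n hn => h n (by omega)
    rcases Nat.lt_succ_iff_lt_or_eq.mp hk with hk' | rfl
    · exact hlow k hk'
    · have h1 := constantCoeff_iterate_jetTheta_eq hθ hlow
      rw [h k (Nat.lt_succ_self k)] at h1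
      have hf : (k.factorial : ℚ) ≠ 0 := by positivity
      exact (mul_eq_zero.mp h1.symm).resolve_left hf

/-! ### The substitution `Φ = aeval ![L, 1+X]`, `(1+X)·L′ = 1`, intertwines `D` and `θ` -/

/-- `Φ(X₀) = L`. [this work] -/
theorem aeval_logPair_X_zero (L : ℚ⟦X⟧) :
    MvPolynomial.aeval ![L, 1 + X] (MvPolynomial.X 0 : MvPolynomial (Fin 2) ℤ) = L := by simp

/-- `Φ(X₁) = 1+z`. [this work] -/
theorem aeval_logPair_X_one (L : ℚ⟦X⟧) :
    MvPolynomial.aeval ![L, 1 + X] (MvPolynomial.X 1 : MvPolynomial (Fin 2) ℤ) = 1 + X := by simp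

/-- `Φ(C a) = a`. [this work] -/
theorem aeval_logPair_C (L : ℚ⟦X⟧) (a : ℤ) :
    MvPolynomial.aeval ![L, 1 + X] (MvPolynomial.C a : MvPolynomial (Fin 2) ℤ) = C (a : ℚ) := by
  simp [map_intCast]

/-- INTERTWINING: `Φ(D P) = θ(Φ P)` (`D = royD = ∂₀ + X₁∂₁`, `θ = (1+z)d/dz = d/dw`).
[this work] -/
theorem aeval_logPair_royD {θ : ℚ⟦X⟧ → ℚ⟦X⟧} (hθ : ∀ f, θ f = (1 + X) * d⁄dX ℚ f)
    {L : ℚ⟦X⟧} (hL : (1 + X) * d⁄dX ℚ L = 1) (P : MvPolynomial (Fin 2) ℤ) :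
    MvPolynomial.aeval ![L, 1 + X] (royD P) = θ (MvPolynomial.aeval ![L, 1 + X] P) := by
  induction P using MvPolynomial.induction_on with
  | C a => rw [royD_C, map_zero, aeval_logPair_C, jetTheta_C hθ]
  | add p q hp hq => rw [royD_add, map_add, map_add, hp, hq, hθ, hθ, hθ, map_add, mul_add]
  | mul_X p i hp =>
    rw [royD_mul, map_add, map_mul, map_mul, map_mul, jetTheta_mul hθ, hp]
    have hi : i = 0 ∨ i = 1 := by fin_cases i <;> simp
    rcases hi with rfl | rfl
    · rw [royD_X_zero, map_one, aeval_logPair_X_zero, hθ L, hL]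
    · rw [royD_X_one, aeval_logPair_X_one, jetTheta_one_add_X hθ]

/-- Iterated intertwining: `Φ(Dⁿ P) = θⁿ(Φ P)`. [this work] -/
theorem aeval_logPair_iterate_royD {θ : ℚ⟦X⟧ → ℚ⟦X⟧} (hθ : ∀ f, θ f = (1 + X) * d⁄dX ℚ f)
    {L : ℚ⟦X⟧} (hL : (1 + X) * d⁄dX ℚ L = 1) (n : ℕ) (P : MvPolynomial (Fin 2) ℤ) :
    MvPolynomial.aeval ![L, 1 + X] (royD^[n] P) = θ^[n] (MvPolynomial.aeval ![L, 1 + X] P) := by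
  induction n generalizing P with
  | zero => rfl
  | succ n ih =>
    rw [Function.iterate_succ_apply, Function.iterate_succ_apply, ← aeval_logPair_royD hθ hL, ih]

/-- The constant term of `Φ(P)` is `P(0,1)` (when `L(0) = 0`). [this work] -/
theorem constantCoeff_aeval_logPair {L : ℚ⟦X⟧} (hL0 : constantCoeff L = 0)
    (P : MvPolynomial (Fin 2) ℤ) :
    constantCoeff (MvPolynomial.aeval ![L, 1 + X] P) = ((MvPolynomial.eval ![0, 1] P : ℤ) : ℚ) := by
  induction P using MvPolynomial.induction_on with
  | C a => rw [aeval_logPair_C, constantCoeff_C, MvPolynomial.eval_C]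
  | add p q hp hq => rw [map_add, map_add, hp, hq, map_add, Int.cast_add]
  | mul_X p i hp =>
    rw [map_mul, map_mul, hp, map_mul, MvPolynomial.eval_X, Int.cast_mul]
    have hi : i = 0 ∨ i = 1 := by fin_cases i <;> simp
    rcases hi with rfl | rfl
    · rw [aeval_logPair_X_zero, hL0]; simp
    · rw [aeval_logPair_X_one]; simp

/-- KEY IDENTITY: `taylorInt n P = [z⁰] θⁿ Φ(P)`. [this work] -/
theorem taylorInt_eq_constantCoeff {θ : ℚ⟦X⟧ → ℚ⟦X⟧} (hθ : ∀ f, θ f = (1 + X) * d⁄dX ℚ f)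
    {L : ℚ⟦X⟧} (hL : (1 + X) * d⁄dX ℚ L = 1) (hL0 : constantCoeff L = 0) (n : ℕ)
    (P : MvPolynomial (Fin 2) ℤ) :
    (taylorInt n P : ℚ) = constantCoeff (θ^[n] (MvPolynomial.aeval ![L, 1 + X] P)) := by
  rw [taylorInt, ← aeval_logPair_iterate_royD hθ hL, constantCoeff_aeval_logPair hL0]

/-- ORDER TRANSFER: `c_n(P) = 0` for `n < m` ⇒ `[zᵏ]Φ(P) = 0` for `k < m`. [this work] -/
theorem coeff_aeval_logPair_eq_zero {θ : ℚ⟦X⟧ → ℚ⟦X⟧} (hθ : ∀ f, θ f = (1 + X) * d⁄dX ℚ f)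
    {L : ℚ⟦X⟧} (hL : (1 + X) * d⁄dX ℚ L = 1) (hL0 : constantCoeff L = 0)
    (P : MvPolynomial (Fin 2) ℤ) {m : ℕ} (h : ∀ n < m, taylorInt n P = 0) :
    ∀ k < m, coeff k (MvPolynomial.aeval ![L, 1 + X] P) = 0 :=
  coeff_eq_zero_of_constantCoeff_iterate_jetTheta hθ m fun n hn => by
    rw [← taylorInt_eq_constantCoeff hθ hL hL0, h n hn, Int.cast_zero]

/-- LEADING TERM: `c_n(P) = 0` for `n < m` ⇒ `c_m(P) = m!·[zᵐ]Φ(P)`. [this work] -/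
theorem taylorInt_eq_factorial_mul_coeff {θ : ℚ⟦X⟧ → ℚ⟦X⟧}
    (hθ : ∀ f, θ f = (1 + X) * d⁄dX ℚ f) {L : ℚ⟦X⟧} (hL : (1 + X) * d⁄dX ℚ L = 1)
    (hL0 : constantCoeff L = 0) (P : MvPolynomial (Fin 2) ℤ) {m : ℕ}
    (h : ∀ n < m, taylorInt n P = 0) :
    (taylorInt m P : ℚ) = (m.factorial : ℚ) * coeff m (MvPolynomial.aeval ![L, 1 + X] P) := by
  rw [taylorInt_eq_constantCoeff hθ hL hL0]
  exact constantCoeff_iterate_jetTheta_eq hθ (coeff_aeval_logPair_eq_zero hθ hL hL0 P h)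

/-! ### The `p`-integrality profile `S_p = {f : |f_j|_p ≤ p^{⌊j/p⌋} ∀ j}` -/

/-- A series with integer coefficients lies in `S_p`. [this work] -/
theorem mem_jetSp_of_int {p : ℕ} [Fact p.Prime] {f : ℚ⟦X⟧} (h : ∀ j, ∃ z : ℤ, coeff j f = z) :
    ∀ j, padicNorm p (coeff j f) ≤ (p : ℚ) ^ (j / p) := by
  intro j
  obtain ⟨z, hz⟩ := h j
  rw [hz]
  exact (padicNorm.of_int z).trans
    (one_le_pow₀ (by exact_mod_cast (Fact.out : p.Prime).one_lt.le))

/-- `S_p` is closed under addition. [this work] -/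
theorem jetSp_add_mem {p : ℕ} [Fact p.Prime] {f g : ℚ⟦X⟧}
    (hf : ∀ j, padicNorm p (coeff j f) ≤ (p : ℚ) ^ (j / p))
    (hg : ∀ j, padicNorm p (coeff j g) ≤ (p : ℚ) ^ (j / p)) :
    ∀ j, padicNorm p (coeff j (f + g)) ≤ (p : ℚ) ^ (j / p) := by
  intro j
  rw [map_add]
  exact padicNorm.nonarchimedean.trans (max_le (hf j) (hg j))

/-- `S_p` is closed under multiplication (`⌊i/p⌋ + ⌊j/p⌋ ≤ ⌊(i+j)/p⌋`). [this work] -/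
theorem jetSp_mul_mem {p : ℕ} [Fact p.Prime] {f g : ℚ⟦X⟧}
    (hf : ∀ j, padicNorm p (coeff j f) ≤ (p : ℚ) ^ (j / p))
    (hg : ∀ j, padicNorm p (coeff j g) ≤ (p : ℚ) ^ (j / p)) :
    ∀ j, padicNorm p (coeff j (f * g)) ≤ (p : ℚ) ^ (j / p) := by
  intro j
  have hp1 : (1 : ℚ) ≤ p := by exact_mod_cast (Fact.out : p.Prime).one_lt.le
  rw [coeff_mul]
  refine padicNorm.sum_le' (fun x hx => ?_) (by positivity)
  rw [padicNorm.mul]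
  have hsum : x.1 + x.2 = j := Finset.HasAntidiagonal.mem_antidiagonal.mp hx
  calc padicNorm p (coeff x.1 f) * padicNorm p (coeff x.2 g)
      ≤ (p : ℚ) ^ (x.1 / p) * (p : ℚ) ^ (x.2 / p) :=
        mul_le_mul (hf x.1) (hg x.2) (padicNorm.nonneg _) (by positivity)
    _ = (p : ℚ) ^ (x.1 / p + x.2 / p) := by rw [pow_add]
    _ ≤ (p : ℚ) ^ (j / p) := pow_le_pow_right₀ hp1 (hsum ▸ Nat.add_div_le_add_div _ _ _)

/-- `1 + z ∈ S_p`. [this work] -/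
theorem one_add_X_mem_jetSp {p : ℕ} [Fact p.Prime] :
    ∀ j, padicNorm p (coeff j (1 + X : ℚ⟦X⟧)) ≤ (p : ℚ) ^ (j / p) := by
  refine mem_jetSp_of_int fun j => ?_
  rcases j with _ | _ | j
  · exact ⟨1, by simp⟩
  · exact ⟨1, by simp⟩
  · exact ⟨0, by simp [coeff_X]⟩

/-- `Φ(P) ∈ S_p` for every `P ∈ ℤ[X₀,X₁]` once `L ∈ S_p`, i.e. `ℤ[L, 1+z] ⊂ S_p`. [this work] -/
theorem aeval_logPair_mem_jetSp {p : ℕ} [Fact p.Prime] {L : ℚ⟦X⟧}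
    (hL : ∀ j, padicNorm p (coeff j L) ≤ (p : ℚ) ^ (j / p)) (P : MvPolynomial (Fin 2) ℤ) :
    ∀ j, padicNorm p (coeff j (MvPolynomial.aeval ![L, 1 + X] P)) ≤ (p : ℚ) ^ (j / p) := by
  induction P using MvPolynomial.induction_on with
  | C a =>
    rw [aeval_logPair_C]
    exact mem_jetSp_of_int fun j => by
      rcases j with _ | j
      · exact ⟨a, by rw [coeff_zero_C]⟩
      · exact ⟨0, by rw [coeff_C, if_neg (Nat.add_one_ne_zero j), Int.cast_zero]⟩
  | add p q hp hq => rw [map_add]; exact jetSp_add_mem hp hq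
  | mul_X q i hq =>
    rw [map_mul]
    have hi : i = 0 ∨ i = 1 := by fin_cases i <;> simp
    rcases hi with rfl | rfl
    · rw [aeval_logPair_X_zero]; exact jetSp_mul_mem hq hL
    · rw [aeval_logPair_X_one]; exact jetSp_mul_mem hq one_add_X_mem_jetSp

/-! ### The series `log(1+z) = Σ_{j ≥ 1} (−1)^{j+1} zʲ/j` -/

/-- `(1+z)·(log(1+z))′ = 1`. [folklore] -/
theorem one_add_X_mul_derivative_logSeries : (1 + X : ℚ⟦X⟧) *
    d⁄dX ℚ (PowerSeries.mk fun j : ℕ => ite (j = 0) (0 : ℚ) ((-1) ^ (j + 1) / (j : ℚ))) = 1 := by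
  ext k
  rw [coeff_jetTheta (θ := fun f => (1 + X : ℚ⟦X⟧) * d⁄dX ℚ f) (fun f => rfl), coeff_mk,
    coeff_mk, coeff_one]
  rcases k with _ | k
  · simp
  · have h1 : ((k : ℚ) + 1) ≠ 0 := by positivity
    have h2 : ((k : ℚ) + 1 + 1) ≠ 0 := by positivity
    simp only [Nat.add_one_ne_zero, if_false]
    push_cast
    rw [mul_div_cancel₀ _ h1, mul_div_cancel₀ _ h2]
    ring

/-- `v_p(j) ≤ ⌊j/p⌋` (since `j ≥ p^{v_p(j)} ≥ p·v_p(j)`). [folklore] -/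
theorem padicValNat_le_div {p : ℕ} [hp : Fact p.Prime] (j : ℕ) : padicValNat p j ≤ j / p := by
  rcases Nat.eq_zero_or_pos j with rfl | hj
  · simp
  rw [Nat.le_div_iff_mul_le hp.out.pos]
  rcases Nat.eq_zero_or_pos (padicValNat p j) with h0 | hv
  · rw [h0]; simp
  calc padicValNat p j * p ≤ p ^ (padicValNat p j - 1) * p :=
        Nat.mul_le_mul_right _
          (by have := Nat.lt_pow_self (n := padicValNat p j - 1) hp.out.one_lt; omega)
    _ = p ^ padicValNat p j := by rw [← pow_succ, Nat.sub_add_cancel hv]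
    _ ≤ j := Nat.le_of_dvd hj pow_padicValNat_dvd

/-- `log(1+z) ∈ S_p`: `|1/j|_p = p^{v_p(j)} ≤ p^{⌊j/p⌋}`. [this work] -/
theorem logSeries_mem_jetSp {p : ℕ} [hp : Fact p.Prime] : ∀ j, padicNorm p (coeff j
    (PowerSeries.mk fun j : ℕ => ite (j = 0) (0 : ℚ) ((-1) ^ (j + 1) / (j : ℚ)))) ≤
      (p : ℚ) ^ (j / p) := by
  intro j
  rw [coeff_mk]
  have hp1 : (1 : ℚ) ≤ p := by exact_mod_cast hp.out.one_lt.le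
  split_ifs with hj
  · rw [padicNorm.zero]; positivity
  · rw [padicNorm.div, padicNorm.eq_zpow_of_nonzero (by positivity),
      show ((-1 : ℚ) ^ (j + 1)) = (((-1) ^ (j + 1) : ℤ) : ℚ) by push_cast; ring,
      padicValRat.of_int, padicValInt, Int.natAbs_pow, Int.natAbs_neg, Int.natAbs_one, one_pow,
      padicValNat_one_right, padicNorm.eq_zpow_of_nonzero (by exact_mod_cast hj),
      padicValRat.of_nat]
    simp only [CharP.cast_eq_zero, neg_zero, zpow_zero, zpow_neg, zpow_natCast, one_div, inv_inv]
    exact pow_le_pow_right₀ hp1 (padicValNat_le_div j)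

/-! ### Theorem U (divisibility) -/

/-- Legendre's step: `v_p(m!) = v_p(⌊m/p⌋!) + ⌊m/p⌋`. [folklore] -/
theorem padicValNat_factorial_eq_div {p : ℕ} [hp : Fact p.Prime] (m : ℕ) :
    padicValNat p m.factorial = padicValNat p (m / p).factorial + m / p := by
  conv_lhs => rw [← Nat.div_add_mod m p]
  rw [padicValNat_factorial_mul_add (m / p) (Nat.mod_lt m hp.out.pos), padicValNat_factorial_mul]

/-- **Theorem U, `p`-adic form.** If `c_n(P) = 0` for all `n < m`, then
`|c_m(P)|_p ≤ p^{−v_p(⌊m/p⌋!)}`. [this work] -/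
theorem padicNorm_taylorInt_le {p : ℕ} [hp : Fact p.Prime] (P : MvPolynomial (Fin 2) ℤ)
    {m : ℕ} (h : ∀ n < m, taylorInt n P = 0) :
    padicNorm p (taylorInt m P : ℚ) ≤ (p : ℚ) ^ (-(padicValNat p (m / p).factorial : ℤ)) := by
  have hp0 : (p : ℚ) ≠ 0 := by exact_mod_cast hp.out.ne_zero
  have hL0 : constantCoeff
      (PowerSeries.mk fun j : ℕ => ite (j = 0) (0 : ℚ) ((-1) ^ (j + 1) / (j : ℚ))) = 0 := by
    rw [← coeff_zero_eq_constantCoeff_apply, coeff_mk, if_pos rfl]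
  rw [taylorInt_eq_factorial_mul_coeff (θ := fun f => (1 + X : ℚ⟦X⟧) * d⁄dX ℚ f) (fun f => rfl)
    one_add_X_mul_derivative_logSeries hL0 P h, padicNorm.mul,
    padicNorm.eq_zpow_of_nonzero (by positivity), ← padicValRat_of_nat,
    padicValNat_factorial_eq_div (p := p) m]
  calc (p : ℚ) ^ (-((padicValNat p (m / p).factorial + m / p : ℕ) : ℤ)) * padicNorm p (coeff m _)
      ≤ (p : ℚ) ^ (-((padicValNat p (m / p).factorial + m / p : ℕ) : ℤ)) * (p : ℚ) ^ (m / p) :=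
        mul_le_mul_of_nonneg_left (aeval_logPair_mem_jetSp logSeries_mem_jetSp P m)
          (by positivity)
    _ = (p : ℚ) ^ (-(padicValNat p (m / p).factorial : ℤ)) := by
        rw [← zpow_natCast, ← zpow_add₀ hp0]
        congr 1
        push_cast
        ring

/-- **Theorem U (divisibility, prime by prime).** If `taylorInt n P = 0` for all `n < m`, then
`p^{v_p(⌊m/p⌋!)} ∣ taylorInt m P` for every prime `p`; i.e. `v_p(c_m(P)) ≥ v_p(m!) − ⌊m/p⌋`.
[this work] -/
theorem pow_padicValNat_dvd_taylorInt {p : ℕ} [Fact p.Prime] (P : MvPolynomial (Fin 2) ℤ)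
    {m : ℕ} (h : ∀ n < m, taylorInt n P = 0) :
    ((p ^ padicValNat p (m / p).factorial : ℕ) : ℤ) ∣ taylorInt m P :=
  padicNorm.dvd_iff_norm_le.mpr (padicNorm_taylorInt_le P h)

/-- **Theorem U (divisibility).** If `ord₀ P(w,e^w) ≥ m`, i.e. `taylorInt n P = 0` for all
`n < m`, then the universal content `g_m = ∏_{p ≤ m prime} p^{v_p(⌊m/p⌋!)}` (`= ∏_{j≤m} j/rad j
= 1,1,1,1,2,2,2,2,8,24,24,24,48,…`) divides `taylorInt m P = (d/dw)^m P(w,e^w)|₀`. [this work] -/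
theorem padeContent_dvd_taylorInt (P : MvPolynomial (Fin 2) ℤ) {m : ℕ}
    (h : ∀ n < m, taylorInt n P = 0) :
    ((∏ p ∈ (Finset.range (m + 1)).filter Nat.Prime, p ^ padicValNat p (m / p).factorial : ℕ)
      : ℤ) ∣ taylorInt m P := by
  rw [Nat.cast_prod]
  refine Finset.prod_dvd_of_coprime (fun p hp q hq hpq => ?_) (fun p hp => ?_)
  · simp only [Finset.coe_filter, Set.mem_setOf_eq] at hp hq
    simp only [Function.onFun, Nat.cast_pow]
    exact ((Nat.coprime_primes hp.2 hq.2).mpr hpq).isCoprime.pow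
  · have : Fact p.Prime := ⟨(Finset.mem_filter.mp hp).2⟩
    exact pow_padicValNat_dvd_taylorInt P h

end Summit.Schanuel.Schanuel.Theorems

end
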